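import Summits.HubbardSuperconductivity.HubbardSuperconductivity.Theorems.KLProgrammeKLRegimeScaleZeroCovarianceFreqMomentumJets

/-!
# Route `KLProgramme`, crux K3 — engine-flow child (stmt-HubbardSuperconductivity-20437), stub (C) at `n = 0`, located brick «A-SIZES-WEIGHTED» (pen (R181)),
# brick 2: the `N`-th FREQUENCY derivative of the infinite-lattice kernel `a_ω(z)` decays off site like `(1+‖z‖)⁻ⁿ` with an `O(m(ω)^{−N−2})` constant

Cell gate-hubbard-kl, seat p1 g20.  `…KernelFreqRegularity` identifies `∂_ωᴺ a_ω(z)` with the Fourier coefficient of the `N`-th time derivative of the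
space–time field `ω ↦ descend g_ω`; `…FreqMomentumJets` identifies that derivative with the spatial function of `TᴺΨ₂` and bounds its momentum jets.
Hence, by `SampledSmoothSymbolPeriodisation.norm_mFourierCoeff_descend_le_inv_pow_of_ne_zero` (off site only derivatives enter):

* `iterate_timeDerivWithin_descend_eq` — `(∂ₜᴺ Φ)(ω) = descend (y ↦ (TᴺΨ₂)(ω, e_K(2πy)))` as functions on `T²`;
* **`norm_iteratedDeriv_latticeKernel_freq_le_offSite`** — for `z ≠ 0`, `n ≥ 1`:
  `‖∂_ωᴺ a_ω(z)‖ ≤ [n!·(c·B·(N+n+1)!·(2/m(ω))^{N+2}·max(1,2/m(ω))^{n−1})·(2π·D_K)ⁿ/πⁿ]·(1+‖z‖_∞)⁻ⁿ` (cutoff table to order `N+n`, band jets `≤ D_Kⁱ`);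
* **`norm_iteratedDeriv_latticeKernel_freq_le_offSite_bare_tab`** — bare frame, table-free (`D_K = 4`, `B = klChi2CauchyTab (N+n)`).

With brick 3 (general-`N` Fourier decay `|t|ᴺ‖𝓕G(t/2π)‖ ≤ ∫‖∂_ωᴺG‖`, successor) this is the JOINT space–time decay `|ǧ(z,t)| ≤ K_{N,n}(1+‖z‖)⁻ⁿ|t|⁻ᴺ` of the
`β = ∞` kernel, `β`-, `M`-, `L`-free — the input of the weighted `a`-sizes.

Proofs only; no definitions; nothing here asserts (C), any stub of 20437, K3 or superconductivity.  References: BGM 2006 §2.2 (2.36aa), §3 (3.2)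
[cite: BenfattoGiulianiMastropietro2006]; Grafakos 2014 Prop. 3.2.6 [cite: Grafakos2014].
-/

noncomputable section

namespace Summit.HubbardSuperconductivity.HubbardSuperconductivity.Theorems.KLRegimeSplit

set_option linter.dupNamespace false -- summit = problem name (single-conjunct summit), D-0017

open Literature.MathematicalPhysics.QuantumLattice Literature.Probability.LatticeModels Literature.Analysis.FunctionSpaces
open Summit.HubbardSuperconductivity.HubbardSuperconductivity.Theorems.DispersionFlow
open Summit.HubbardSuperconductivity.HubbardSuperconductivity.Theorems.EngineV8 (norm_iteratedFDeriv_frameLevel_zero_le)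
open MeasureTheory Set Complex UnitAddTorus Real Torus
open scoped ContDiff Nat

/-- **The `N`-th time derivative of the field `ω ↦ descend g_ω` is the descent of the spatial function of `TᴺΨ₂`** (`0 < Λ`). -/
theorem iterate_timeDerivWithin_descend_eq (c : ℝ) {Λ : ℝ} (hΛ : 0 < Λ) (μ : ℝ) (K : TrigPolyC4v) (N : ℕ) (om : ℝ) :
    ((timeDerivWithin univ)^[N] (fun om : ℝ => Torus.descend (fun y : Momentum => uvSymbolFn c Λ (frameLevel μ K ((2 * π) • y)) om)
        (uvSpatialSymbol_isLatticePeriodic c Λ μ K om))) om =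
      Torus.descend (fun y : Momentum => ((fun (ψ : FreqBand → ℂ) => fun x => fderiv ℝ ψ x fbE0)^[N] (uvSymbol₂ c Λ))
        (fbPt om (frameLevel μ K ((2 * π) • y)))) (freqDeriv_uvSpatialSymbol_isLatticePeriodic c Λ μ K om N) := by
  funext x
  rw [iterate_timeDerivWithin_univ_apply, Torus.descend_apply]
  have hslice : (fun s : ℝ => Torus.descend (fun y : Momentum => uvSymbolFn c Λ (frameLevel μ K ((2 * π) • y)) s)
      (uvSpatialSymbol_isLatticePeriodic c Λ μ K s) x) = fun s : ℝ => uvSymbol₂ c Λ (fbPt s (frameLevel μ K ((2 * π) • Torus.repr x))) := by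
    funext s; rw [Torus.descend_apply, uvSymbol₂_fbPt]
  rw [hslice, iteratedDeriv_comp_fbPt_eq_iterate_freqDeriv (contDiff_uvSymbol₂ c hΛ)]

/-- **Off-site decay of the `N`-th frequency derivative of the lattice kernel**: for `z ≠ 0`, `n ≥ 1`, `0 ≤ c`, `0 < Λ`, the cutoff table to order
`N+n` and band jets `‖Dⁱe_K‖ ≤ D_Kⁱ` (`1 ≤ i ≤ n`):
`‖∂_ωᴺ a_ω(z)‖ ≤ [n!·(c·B·(N+n+1)!·(2/m)^{N+2}·max(1,2/m)^{n−1})·(2π·D_K)ⁿ/πⁿ]·(1+‖z‖_∞)⁻ⁿ`. -/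
theorem norm_iteratedDeriv_latticeKernel_freq_le_offSite {c Λ : ℝ} (hc : 0 ≤ c) (hΛ : 0 < Λ) (μ : ℝ) (K : TrigPolyC4v) (N : ℕ) {n : ℕ}
    (hn1 : 1 ≤ n) {B : ℝ} (hB1 : 1 ≤ B) (hB : ∀ j ≤ N + n, ∀ t, ‖iteratedDeriv j salmhoferCutoff t‖ ≤ B) {DK : ℝ}
    (hK : ∀ i : ℕ, 1 ≤ i → i ≤ n → ∀ q : Momentum, ‖iteratedFDeriv ℝ i (frameLevel μ K) q‖ ≤ DK ^ i) {z : Site 2} (hz : z ≠ 0) (om : ℝ) :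
    ‖iteratedDeriv N (fun om : ℝ => mFourierCoeff (Torus.descend (fun y : Momentum => uvSymbolFn c Λ (frameLevel μ K ((2 * π) • y)) om)
        (uvSpatialSymbol_isLatticePeriodic c Λ μ K om)) z) om‖ ≤
      (n ! * (c * B * (N + n + 1) ! * (2 / max |om| (Λ / 2)) ^ (N + 2) * (max 1 (2 / max |om| (Λ / 2))) ^ (n - 1)) * ((2 * π) * DK) ^ n) /
        Real.pi ^ n * ((1 + ‖z‖) ^ n)⁻¹ := by
  rw [iteratedDeriv_mFourierCoeff_of_isSmoothSpaceTimeOn (isSmoothSpaceTimeOn_uvSpatialSymbol_descend c hΛ μ K) z N]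
  show ‖mFourierCoeff (((timeDerivWithin univ)^[N] (fun om : ℝ => Torus.descend
      (fun y : Momentum => uvSymbolFn c Λ (frameLevel μ K ((2 * π) • y)) om) (uvSpatialSymbol_isLatticePeriodic c Λ μ K om))) om) z‖ ≤ _
  rw [iterate_timeDerivWithin_descend_eq c hΛ μ K N om]
  exact norm_mFourierCoeff_descend_le_inv_pow_of_ne_zero (freqDeriv_uvSpatialSymbol_isLatticePeriodic c Λ μ K om N)
    (freqDeriv_uvSpatialSymbol_contDiff c hΛ μ K om N) (norm_iteratedFDeriv_freqDeriv_uvSpatialSymbol_le_of_one_le hc hΛ μ K om N hn1 hB1 hB hK) hz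

/-- **Bare frame, table-free**: `‖∂_ωᴺ a_ω(z)‖ ≤ [n!·(c·klChi2CauchyTab(N+n)·(N+n+1)!·(2/m)^{N+2}·max(1,2/m)^{n−1})·(8π)ⁿ/πⁿ]·(1+‖z‖_∞)⁻ⁿ` at `K = 0`,
`z ≠ 0`, `n ≥ 1`, `0 ≤ c`, `0 < Λ`. -/
theorem norm_iteratedDeriv_latticeKernel_freq_le_offSite_bare_tab {c Λ : ℝ} (hc : 0 ≤ c) (hΛ : 0 < Λ) (μ : ℝ) (N : ℕ) {n : ℕ} (hn1 : 1 ≤ n)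
    {z : Site 2} (hz : z ≠ 0) (om : ℝ) :
    ‖iteratedDeriv N (fun om : ℝ => mFourierCoeff (Torus.descend (fun y : Momentum => uvSymbolFn c Λ (frameLevel μ 0 ((2 * π) • y)) om)
        (uvSpatialSymbol_isLatticePeriodic c Λ μ 0 om)) z) om‖ ≤
      (n ! * (c * klChi2CauchyTab (N + n) * (N + n + 1) ! * (2 / max |om| (Λ / 2)) ^ (N + 2) * (max 1 (2 / max |om| (Λ / 2))) ^ (n - 1)) *
          ((2 * π) * 4) ^ n) / Real.pi ^ n * ((1 + ‖z‖) ^ n)⁻¹ := by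
  refine norm_iteratedDeriv_latticeKernel_freq_le_offSite hc hΛ μ 0 N hn1 (one_le_klChi2CauchyTab (N + n))
    (salmhoferCutoff_flat_cauchy_table_deriv (N + n)) (fun i hi1 _ q => ?_) hz om
  calc ‖iteratedFDeriv ℝ i (frameLevel μ 0) q‖ ≤ 4 := norm_iteratedFDeriv_frameLevel_zero_le μ hi1 q
    _ = 4 ^ 1 := (pow_one _).symm
    _ ≤ 4 ^ i := pow_le_pow_right₀ (by norm_num) hi1

end Summit.HubbardSuperconductivity.HubbardSuperconductivity.Theorems.KLRegimeSplit

end
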